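import Summits.CriticalPhenomena.PercolationContinuityZ3.Theorems.Transplant.FKConnectivityAllQAntipodalSplitDefs
import Summits.CriticalPhenomena.PercolationContinuityZ3.Theorems.Transplant.FKConnectivityAllQPendantTools
import HarnessLib

/-!
# Connectivity correlation inequalities for `φ_{w,q}` — file (DEFINITION): the SPLIT up-correlation functional `U¹¹` and its
# series case `q · U¹¹(y · M) = V(M)`

Definitions file (`--supports stmt-CriticalPhenomena-4575`), FK sub-lane `prim-bschramm-fk-2` (gen 12); builds on p205010 (kernel
theorem, internal audit signed; external expert review pending).  No named facts, no sorries, standard axioms.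

Gen 11's CONJECTURE U¹¹ (memo `bschramm/FROM-fk-2-g11-ANTIPODAL-UPC.md` §3.5, FK-Q2.md §20): for a two-terminal series–parallel
network `E` between `s, t`, two free edges `y ≠ z` of `E`, `0 < q ≤ 1` and every `h` monotone on the subsets of `E` not reading `y, z`,
the antipodal up-correlation functional RESTRICTED TO THE COMPLEMENTARY PAIRS THAT SPLIT `{y, z}`,
`apUpcSplit q E s t y z h = ∑_{γ ⊆ E, |γ ∩ {y,z}| = 1} q^{k(γ)+k(E∖γ)} (1{s↔t in γ} - 1{s↔t in E∖γ}) h(γ)`, is `≥ 0`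
(it implies `C_∞` for the majority type at `|supp f| = 3`).  This file DEFINES the functional and proves the first reduction of the
programme of `…AntipodalSplitDefs`: if `y = s₀s` is a PENDANT edge in series with the rest (`N = y · M`, new terminal `s₀`), then
`q · apUpcSplit q (E(M) ∪ {y}) s₀ t y z h = apV q (E(M) ∖ z) s t u v g` (`z = uv`, `g` = `h` with `y, z` forgotten) — so that, by
`apV_nonneg_of_apX2_nonneg`, Conjecture U¹¹ for all networks of the form `y · M` follows from the node `ApX2Pos` (`apX2 ≥ 0`).
* `FK.apUpcSplit` — the definition (indicator form over `E.powerset`);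
* `FK.apUpcSplit_pendant_eq_apV` — the identity;
* `FK.apUpcSplit_pendant_nonneg_of_apX2_nonneg` — `0 < q ≤ 1`, `M` TTSP between `s, t`, `z ∈ E(M)`, `apX2 ≥ 0` ⟹ `apUpcSplit (y·M) ≥ 0`.
[cite: Grimmett2006, §1.4 eq. (1.20) (p. 15); §3.8 (pp. 61–62); §3.9 (p. 63)]
-/

noncomputable section

namespace Summit.CriticalPhenomena.PercolationContinuityZ3.Theorems

namespace FK

open SimpleGraph Literature.Probability.LatticeModels Literature.Probability.Percolation
open scoped Classical

variable {V : Type*}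

/-- Indicator (as a real number) that the configuration `γ` SPLITS the marked pair of edges `{y, z}`: exactly one of them lies in `γ`.
[folklore] -/
def splitInd (y z : Sym2 V) (γ : Finset (Sym2 V)) : ℝ := if (y ∈ γ ↔ z ∉ γ) then 1 else 0

/-- **Split antipodal up-correlation functional `U¹¹`** of the two-terminal network `(E; s, t)` with marked edges `y, z`:
`apUpcSplit q E s t y z h = ∑_{γ ⊆ E, |γ ∩ {y,z}| = 1} q^{k(γ)+k(E∖γ)} (1{s ↔ t in γ} - 1{s ↔ t in E∖γ}) h(γ)` — the functional
`apUpc` of `…AntipodalDefs` restricted to the complementary pairs that split `{y, z}` (gen 11's Conjecture U¹¹ asserts `≥ 0` for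
`0 < q ≤ 1` on series–parallel networks and `h` monotone not reading `y, z`). [cite: Grimmett2006, §1.4 eq. (1.20) (p. 15); §3.9 (p. 63)] -/
def apUpcSplit (q : ℝ) (E : Finset (Sym2 V)) (s t : V) (y z : Sym2 V) (h : Finset (Sym2 V) → ℝ) : ℝ :=
  ∑ γ ∈ E.powerset, q ^ apExp E γ * (splitInd y z γ * ((apConn γ s t - apConn (E \ γ) s t) * h γ))

section Pendant

variable [Fintype V]

omit [Fintype V] in
/-- A vertex met by no edge of `A` is not joined to any other vertex in the open graph of `A`. [folklore] -/
theorem apConn_eq_zero_of_isolated {A : Finset (Sym2 V)} {x b : V} (hx : ∀ e ∈ A, x ∉ e) (hb : b ≠ x) :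
    apConn A x b = 0 :=
  apConn_of_not_reachable (not_reachable_of_isolated (ω := (↑A : BondConfig V)) (fun e he => hx e (Finset.mem_coe.1 he)) hb)

/-- **Pendant edge**: if `s₀` is met by no edge of `A` and `s₀ ≠ t`, then `s₀ ↔ t` in `A ∪ {s₀s}` iff `s ↔ t` in `A`.
[folklore] -/
theorem apConn_insert_pendant {A : Finset (Sym2 V)} {s₀ s t : V} (hA : ∀ e ∈ A, s₀ ∉ e) (ht : s₀ ≠ t) :
    apConn (insert s(s₀, s) A) s₀ t = apConn A s t := by
  have hω : ∀ e ∈ (↑(insert s(s₀, s) A) : BondConfig V), s₀ ∈ e → e = s(s₀, s) := by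
    intro e he hs₀e
    rcases Finset.mem_insert.1 (Finset.mem_coe.1 he) with rfl | heA
    · rfl
    · exact absurd hs₀e (hA e heA)
  have key := pendant_reachable_hub_iff (ω := (↑(insert s(s₀, s) A) : BondConfig V)) ht.symm hω
  have hdiff : ((↑(insert s(s₀, s) A) : BondConfig V) \ {s(s₀, s)}) = (↑A : BondConfig V) := by
    have hy : s(s₀, s) ∉ A := fun h => hA _ h (Sym2.mem_mk_left _ _)
    rw [Finset.coe_insert, Set.insert_sdiff_self_of_notMem (fun h => hy (Finset.mem_coe.1 h))]
  rw [hdiff] at key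
  have hmem : s(s₀, s) ∈ ((↑(insert s(s₀, s) A)) : BondConfig V) := Finset.mem_coe.2 (Finset.mem_insert_self _ _)
  simp only [hmem, true_and] at key
  by_cases hr : (openGraph (↑A : BondConfig V)).Reachable s t
  · rw [apConn_of_reachable hr, apConn_of_reachable (key.2 hr)]
  · rw [apConn_of_not_reachable hr, apConn_of_not_reachable (fun h => hr (key.1 h))]

/-- Cluster count of a pendant edge: `k(A ∪ {s₀s}) + 1 = k(A)` when `s₀` is met by no edge of `A` and `s₀ ≠ s`. [cite: Grimmett2006, §1.2] -/
theorem clusterCount_insert_pendant {A : Finset (Sym2 V)} {s₀ s : V} (hA : ∀ e ∈ A, s₀ ∉ e) (hs : s₀ ≠ s) :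
    clusterCount (↑(insert s(s₀, s) A) : BondConfig V) ∅ + 1 = clusterCount (↑A : BondConfig V) ∅ := by
  have h := clusterCount_insert A s₀ s (∅ : Set V)
  simp only [wired_empty, sup_bot_eq] at h
  rwa [if_neg (not_reachable_of_isolated (ω := (↑A : BondConfig V)) (fun e he => hA e (Finset.mem_coe.1 he)) hs.symm)] at h

/-- **`q · U¹¹(y · M) = V(M)`.**  Let `T` be an edge set (the network `M` minus its marked edge `z = uv`), `s, t` its terminals, and
`s₀` a fresh vertex (met by no edge of `T`, distinct from `s, t, u, v`); put `y = s₀s`, `E = T ∪ {y, z}` (the series composition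
`y · M` with terminals `s₀, t`).  For a test function `h` that does not read `y, z` (`h(A ∪ {y}) = h(A ∪ {z}) = g(A)` for `A ⊆ T`),
`q · apUpcSplit q E s₀ t y z h = apV q T s t u v g`.  (Pairs with `y ∈ γ ∌ z`: `γ = A ∪ {y}` joins `s₀, t` iff `A` joins `s, t`, its
complement `(T∖A) ∪ {z}` never does, and `k(A ∪ {y}) = k(A) - 1`; pairs with `z ∈ γ ∌ y` are the mirror images.)
[cite: Grimmett2006, §1.4 eq. (1.20) (p. 15); §1.2] -/
theorem apUpcSplit_pendant_eq_apV (q : ℝ) {T : Finset (Sym2 V)} {s t u v s₀ : V}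
    (hT : ∀ e ∈ T, s₀ ∉ e) (hz : s(u, v) ∉ T) (hs : s₀ ≠ s) (ht : s₀ ≠ t) (hu : s₀ ≠ u) (hv : s₀ ≠ v)
    {h g : Finset (Sym2 V) → ℝ}
    (hhy : ∀ A ⊆ T, h (insert s(s₀, s) A) = g A) (hhz : ∀ A ⊆ T, h (insert s(u, v) A) = g A) :
    q * apUpcSplit q (insert s(s₀, s) (insert s(u, v) T)) s₀ t s(s₀, s) s(u, v) h = apV q T s t u v g := by
  set y : Sym2 V := s(s₀, s) with hy_def
  set z : Sym2 V := s(u, v) with hz_def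
  have hyz : y ≠ z := by
    intro hyz
    have : s₀ ∈ z := hyz ▸ Sym2.mem_mk_left s₀ s
    rcases Sym2.mem_iff.1 this with h1 | h1
    · exact hu h1
    · exact hv h1
  have hyT : y ∉ T := fun hh => hT _ hh (Sym2.mem_mk_left _ _)
  have hyzT : y ∉ insert z T := by
    rw [Finset.mem_insert]; rintro (h1 | h1); exacts [hyz h1, hyT h1]
  set E := insert y (insert z T) with hE
  -- complements inside `E`
  have sdiff_y : ∀ A ⊆ T, E \ insert y A = insert z (T \ A) := by
    intro A hA; ext e
    simp only [hE, Finset.mem_sdiff, Finset.mem_insert, not_or]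
    constructor
    · rintro ⟨h1 | h1 | h1, hne, hnA⟩
      · exact absurd h1 hne
      · exact Or.inl h1
      · exact Or.inr ⟨h1, hnA⟩
    · rintro (h1 | ⟨h1, h2⟩)
      · refine ⟨Or.inr (Or.inl h1), fun hh => hyz (hh ▸ h1.symm).symm |>.elim, fun hh => hz (h1 ▸ hA hh)⟩
      · exact ⟨Or.inr (Or.inr h1), fun hh => hyT (hh ▸ h1), h2⟩
  have sdiff_z : ∀ A ⊆ T, E \ insert z A = insert y (T \ A) := by
    intro A hA; ext e
    simp only [hE, Finset.mem_sdiff, Finset.mem_insert, not_or]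
    constructor
    · rintro ⟨h1 | h1 | h1, hne, hnA⟩
      · exact Or.inl h1
      · exact absurd h1 hne
      · exact Or.inr ⟨h1, hnA⟩
    · rintro (h1 | ⟨h1, h2⟩)
      · refine ⟨Or.inl h1, fun hh => hyz (h1 ▸ hh), fun hh => hyT (h1 ▸ hA hh)⟩
      · exact ⟨Or.inr (Or.inr h1), fun hh => hz (hh ▸ h1), h2⟩
  have sdiff_0 : ∀ A ⊆ T, E \ A = insert y (insert z (T \ A)) := by
    intro A hA; ext e
    simp only [hE, Finset.mem_sdiff, Finset.mem_insert]
    constructor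
    · rintro ⟨h1 | h1 | h1, hnA⟩
      · exact Or.inl h1
      · exact Or.inr (Or.inl h1)
      · exact Or.inr (Or.inr ⟨h1, hnA⟩)
    · rintro (h1 | h1 | ⟨h1, h2⟩)
      · exact ⟨Or.inl h1, fun hh => hyT (h1 ▸ hA hh)⟩
      · exact ⟨Or.inr (Or.inl h1), fun hh => hz (h1 ▸ hA hh)⟩
      · exact ⟨Or.inr (Or.inr h1), h2⟩
  -- split indicator on the four families
  have ind_A : ∀ A ⊆ T, splitInd y z A = 0 := fun A hA => by
    unfold splitInd; rw [if_neg]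
    intro hh
    exact hz (hA (not_not.1 fun hzA => hyT (hA (hh.2 hzA))))
  have ind_yA : ∀ A ⊆ T, splitInd y z (insert y A) = 1 := fun A hA => by
    unfold splitInd; rw [if_pos]
    exact ⟨fun _ hh => (Finset.mem_insert.1 hh).elim (fun e => hyz e.symm) (fun e => hz (hA e)), fun _ => Finset.mem_insert_self _ _⟩
  have ind_zA : ∀ A ⊆ T, splitInd y z (insert z A) = 1 := fun A hA => by
    unfold splitInd; rw [if_pos]
    constructor
    · intro hh; exact ((Finset.mem_insert.1 hh).elim hyz (fun e => hyT (hA e))).elim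
    · intro hh; exact absurd (Finset.mem_insert_self z A) hh
  have ind_yzA : ∀ A ⊆ T, splitInd y z (insert y (insert z A)) = 0 := fun A hA => by
    unfold splitInd; rw [if_neg]
    intro hh
    exact hh.1 (Finset.mem_insert_self _ _) (Finset.mem_insert_of_mem (Finset.mem_insert_self _ _))
  -- isolation of `s₀`
  have iso_zB : ∀ B ⊆ T, ∀ e ∈ insert z B, s₀ ∉ e := by
    intro B hB e he
    rcases Finset.mem_insert.1 he with rfl | heB
    · intro hh; rcases Sym2.mem_iff.1 hh with h1 | h1; exacts [hu h1, hv h1]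
    · exact hT e (hB heB)
  have iso_B : ∀ B ⊆ T, ∀ e ∈ B, s₀ ∉ e := fun B hB e he => hT e (hB he)
  -- expand the sum over `E.powerset` into the four families
  unfold apUpcSplit
  rw [hE, Finset.sum_powerset_insert hyzT, Finset.sum_powerset_insert hz, Finset.sum_powerset_insert hz]
  -- family `A` and family `A ∪ {y,z}` vanish; evaluate the two split families
  have fam0 : ∑ A ∈ T.powerset, q ^ apExp E A * (splitInd y z A * ((apConn A s₀ t - apConn (E \ A) s₀ t) * h A)) = 0 :=
    Finset.sum_eq_zero fun A hA => by rw [ind_A A (Finset.mem_powerset.1 hA)]; ring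
  have fam3 : ∑ A ∈ T.powerset, q ^ apExp E (insert y (insert z A)) *
      (splitInd y z (insert y (insert z A)) * ((apConn (insert y (insert z A)) s₀ t - apConn (E \ insert y (insert z A)) s₀ t) *
        h (insert y (insert z A)))) = 0 :=
    Finset.sum_eq_zero fun A hA => by rw [ind_yzA A (Finset.mem_powerset.1 hA)]; ring
  have famz : ∀ A ∈ T.powerset, q * (q ^ apExp E (insert z A) *
      (splitInd y z (insert z A) * ((apConn (insert z A) s₀ t - apConn (E \ insert z A) s₀ t) * h (insert z A)))) =
      - (q ^ (clusterCount (↑(T \ A) : BondConfig V) ∅ + clusterCount (↑(insert s(u, v) (T \ (T \ A))) : BondConfig V) ∅) *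
          (apConn (T \ A) s t * g A)) := by
    intro A hA
    have hAT := Finset.mem_powerset.1 hA
    rw [ind_zA A hAT, sdiff_z A hAT, apConn_eq_zero_of_isolated (iso_zB A hAT) ht.symm,
      apConn_insert_pendant (iso_B (T \ A) Finset.sdiff_subset) ht, hhz A hAT, Finset.sdiff_sdiff_eq_self hAT]
    unfold apExp
    rw [sdiff_z A hAT, ← clusterCount_insert_pendant (iso_B (T \ A) Finset.sdiff_subset) hs, hz_def]
    ring
  have famy : ∀ A ∈ T.powerset, q * (q ^ apExp E (insert y A) *
      (splitInd y z (insert y A) * ((apConn (insert y A) s₀ t - apConn (E \ insert y A) s₀ t) * h (insert y A)))) =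
      q ^ (clusterCount (↑A : BondConfig V) ∅ + clusterCount (↑(insert s(u, v) (T \ A)) : BondConfig V) ∅) *
        (apConn A s t * g A) := by
    intro A hA
    have hAT := Finset.mem_powerset.1 hA
    rw [ind_yA A hAT, sdiff_y A hAT, apConn_eq_zero_of_isolated (iso_zB (T \ A) Finset.sdiff_subset) ht.symm,
      apConn_insert_pendant (iso_B A hAT) ht, hhy A hAT]
    unfold apExp
    rw [sdiff_y A hAT, ← clusterCount_insert_pendant (iso_B A hAT) hs, hz_def]
    ring
  rw [fam0, fam3, zero_add, add_zero, mul_add, Finset.mul_sum, Finset.mul_sum, Finset.sum_congr rfl famz,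
    Finset.sum_congr rfl famy]
  -- the `z`-family is the flipped image of the `y`-family
  unfold apV
  have flipz : ∑ A ∈ T.powerset, - (q ^ (clusterCount (↑(T \ A) : BondConfig V) ∅ +
      clusterCount (↑(insert s(u, v) (T \ (T \ A))) : BondConfig V) ∅) * (apConn (T \ A) s t * g A)) =
      ∑ A ∈ T.powerset, - (q ^ (clusterCount (↑A : BondConfig V) ∅ +
        clusterCount (↑(insert s(u, v) (T \ A)) : BondConfig V) ∅) * (apConn A s t * g (T \ A))) := by
    rw [sum_powerset_flip T (fun A => - (q ^ (clusterCount (↑(T \ A) : BondConfig V) ∅ +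
      clusterCount (↑(insert s(u, v) (T \ (T \ A))) : BondConfig V) ∅) * (apConn (T \ A) s t * g A)))]
    refine Finset.sum_congr rfl fun A hA => ?_
    simp only [Finset.sdiff_sdiff_eq_self (Finset.mem_powerset.1 hA)]
  rw [flipz, ← Finset.sum_add_distrib]
  refine Finset.sum_congr rfl fun A _ => ?_
  ring

/-- **Conjecture U¹¹ for `y · M` follows from `apX2 ≥ 0`** (`0 < q ≤ 1`): with the notation of `apUpcSplit_pendant_eq_apV`, if
`T ⊆ E'` for a two-terminal series–parallel network `E'` between `s, t` and `0 ≤ apX2 q T s t u v g` (`g` monotone on the subsets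
of `T`), then `0 ≤ apUpcSplit q (T ∪ {y, z}) s₀ t y z h`.  [cite: Grimmett2006, §3.8 (pp. 61–62); §3.9 (p. 63)] -/
theorem apUpcSplit_pendant_nonneg_of_apX2_nonneg {q : ℝ} (hq0 : 0 < q) (hq1 : q ≤ 1) {E' T : Finset (Sym2 V)}
    {s t u v s₀ : V} (hE' : IsTTSP E' s t) (hTE : T ⊆ E')
    (hT : ∀ e ∈ T, s₀ ∉ e) (hz : s(u, v) ∉ T) (hs : s₀ ≠ s) (ht : s₀ ≠ t) (hu : s₀ ≠ u) (hv : s₀ ≠ v)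
    {h g : Finset (Sym2 V) → ℝ}
    (hhy : ∀ A ⊆ T, h (insert s(s₀, s) A) = g A) (hhz : ∀ A ⊆ T, h (insert s(u, v) A) = g A)
    (hg : ∀ ⦃A B : Finset (Sym2 V)⦄, A ⊆ B → B ⊆ T → g A ≤ g B) (hX : 0 ≤ apX2 q T s t u v g) :
    0 ≤ apUpcSplit q (insert s(s₀, s) (insert s(u, v) T)) s₀ t s(s₀, s) s(u, v) h := by
  have hV := apV_nonneg_of_apX2_nonneg hq0 hq1 hE' hTE u v hg hX
  rw [← apUpcSplit_pendant_eq_apV q hT hz hs ht hu hv hhy hhz] at hV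
  exact (mul_nonneg_iff_of_pos_left hq0).1 hV

end Pendant

end FK

end Summit.CriticalPhenomena.PercolationContinuityZ3.Theorems

end
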